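import Summits.HodgeConjecture.HodgeConjecture.Theorems.Ring2AbelianAllAndreWeightLift
import HarnessLib

/-!
# Ring 2 · sub-cell AbelianAll (ALL ABELIAN VARIETIES), André axis, part XXIV-b — LERAY WEIGHTS: THE FIBRE-SUPPORTED CLAUSE IS EXACT;
# THE LIFT AS "CANONICAL LIFTS ARE ALGEBRAIC" AND AS A DIMENSION COUNT (Abdulali's inequality an equality)

HONEST FRAMING (page 1, verbatim): **research route, not a corollary; conditional on HC_CM plus one named
minimal statement.** Cell line: research route conditional on HC_CM; not a corollary; Q11.4-sentence-2
already refuted in dim ≥ 3. Nothing in this file proves a case of the Hodge conjecture for an abelian variety; `HC_CM` does not occur in this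
file; item `Theses.RankFourFaces.CMToAbelian` (stmt-16267) OPEN and not closed here. Seat `pub-hodge-ring2-ab-andre-2`, gen 16; brief (ii)/(iii).

Hypotheses (wt), (wt₃), (top), (sym) on an endomorphism `ν` of the compact pencil and a weight base `N ≥ 2` are those of part XXIV-a (module
docstring there): print THEOREMS for `ν = θ_N` on an abelian scheme over a curve (Kleiman 1968 p. 374; Abdulali 1994 p. 1122; Milne 2020 proof
of Prop. 1; Deninger–Murre 1991 Thm. 3.1), NOT in the tree, displayed as hypotheses.

## What is proved (theorems only; no definition, no named fact, no sorry)

§3 **`fibreLefschetzDegree_of_comap_le_sup_of_weights`** — (wt), (wt₃) in degree `2(p+1)`, (top) in degree `d+m+2`, (sym) for the datum `D`: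
(L)_t(p+1) ⟹ the fibre-supported clause of part XXIII-f at `(t, D, p)` (`x = ((m+1)a)⁻¹ ·` the top-weight component of any algebraic lift);
**`forall_comap_le_sup_iff_forall_fibreLefschetzDegree_of_weights`** — with part XXIII-f/g (Lieberman for the fibre): [∀ p (L)_t(p)] ⟺
[∀ p the fibre-supported clause at `(t, D, p)`]. THE SHARPEST `B_min` CANDIDATE OF GEN 15 IS EXACT for symmetric data on weighted pencils.
§4 **`comap_le_sup_iff_forall_topWeight_mem`** — (wt), (wt₃), (top) in degree `2(p+1)`: (L)_t(p+1) ⟺ [every TOP-WEIGHT class of `𝒳` whose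
restriction to `X_t` is algebraic IS algebraic] ("the canonical lifts of the invariant algebraic classes are algebraic").
§5 **`comap_le_sup_iff_finrank_topWeight_eq`** — same hypotheses: (L)_t(p+1) ⟺ `dim (N^{p+1}(𝒳) ∩ H^{2p+2}(𝒳)^{wt 2p+2}) =
dim (N^{p+1}(X_t) ∩ Im j_t^*)`; the inequality `≤` (**`finrank_topWeight_le`**) is Abdulali's / Milne's (e2)
`dim aH⁰(S, R^{2r} f_*) ≤ dim aH^{2r}(A_s)^π`, unconditional given the weights.
Node-level rows (display-only brackets `CMWeights[]`, `CMTopWeightLifts[]`; `HC_AV ⟺ HC_CM ∧ [CM top-weight lifts]` mod [h₂₁, Verdier,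
weights]) are in part XXIV-c (`Ring2AbelianAllAndreWeightLiftNodes`).

## Honest status

No node is born; nothing is minimal; nothing here is fact-free progress on `HC_AV`. §4–§5 add one more equivalent READING of (L) beside
Num^CM / PrimCM / F_CM (parts XIX–XXII), granted the print weights: "at a CM fibre of a compact abelian pencil, the canonical (top-weight = flat) lift to the total space of every algebraic
class is algebraic" — equivalently "Abdulali's inequality (e2) is an equality at the CM fibre". FIND-THE-CYCLE (W₆, RING2-MAP AA2.124 restated):
on a compact Weil-type sextic pencil `𝒳⁷ → S` with `θ_N`-weights and an `E`-power fibre `X_t ≅ E⁶`, the canonical lifts `w̃₁, w̃₂ ∈ H⁶(𝒳⁷)` of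
the two Weil classes — the unique weight-`N⁶` classes restricting to them — must be classes of algebraic 3-cycles on the sevenfold (with
large monodromy: `dim N³(𝒳⁷)^{wt 6} = 3`, the third generator being `k₂³`).

References: Kleiman1968AlgebraicCycles (p. 374); Abdulali1994FamiliesAV (p. 1122); Milne2020HodgeClassesAV (proof of Prop. 1, p. 7);
DeningerMurre1991 (Thm. 3.1); Grothendieck1968 (§3 p. 196); Lieberman1968 (Thm. 1); VoisinHodgeI2002 (Thm. 6.25); Andre1996Motifs (§6.3,
Lemme 6.3.1); Verdier1976 (Cor. 5.1).
-/

noncomputable section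

set_option linter.dupNamespace false

namespace Summit.HodgeConjecture.HodgeConjecture.Ring2.AbelianAll

open CategoryTheory AlgebraicGeometry
open Literature.AlgebraicGeometry Literature.AlgebraicGeometry.Motives
open Literature.AlgebraicGeometry.HodgeTheory
open Literature.AlgebraicTopology.SingularHomology (singularCohomology cupProduct)
open Literature.Geometry.Kaehler (lefschetzOperator lefschetzPow HasHardLefschetzProperty)

/-! ## §3 EXACTNESS: the fibre-supported clause of part XXIII-f from the lift -/

section Exactness

variable {𝒳 S : SchemeOver ℂ} {d : ℕ} {f : 𝒳 ⟶ S}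

/-- **THE FIBRE-SUPPORTED CLAUSE FROM THE LIFT.** Let `f : 𝒳 ⟶ S` be a compact pencil of abelian `d`-folds with a locally quasi-finite
endomorphism `ν` carrying the Leray weights in degree `2(p+1)` ((wt), (wt₃)) and (top) in degree `d+m+2` (`2(p+1)+m = d`), and let `D` be a
Kähler–rational datum of `𝒳` that is `ν`-SYMMETRIC modulo the fibre class (`D.Hη = k₂ + a·[X_t]`, `ν^* k₂ = N² k₂`). THEN (L)_t(p+1) IMPLIES
the fibre-supported clause of part XXIII-f at `(t, D, p)`: for every `κ`-primitive invariant algebraic `ξ ∈ H^{2p+2}(X_t)` there is an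
ALGEBRAIC `x ∈ N^{p+1}(𝒳)` with `L_K^{m+1} x = j_{t*}(L_κᵐ ξ)` — namely `x = ((m+1)a)⁻¹ · ξ̃`, `ξ̃` the top-weight component of any algebraic
lift of `ξ` (§1), by the identification (§2); if `(m+1)a = 0` hard Lefschetz forces `ξ = 0` and `x = 0` serves. Together with part XXIII-f
(clause ⟹ (Prim)_t(p+1)) the clause is EXACTLY the lift. [cite: Grothendieck1968, §3 p. 196 (A(X))]
[cite: Milne2020HodgeClassesAV, proof of Prop. 1 (p. 7)] [cite: Abdulali1994FamiliesAV, p. 1122] [cite: DeningerMurre1991, Thm. 3.1]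
[cite: VoisinHodgeI2002, Thm. 6.25] -/
theorem fibreLefschetzDegree_of_comap_le_sup_of_weights (hf : IsCompactAbelianPencil f d) (t : ComplexPoints S)
    (D : KaehlerRationalDatum (d + 1) 𝒳) (ν : 𝒳 ⟶ 𝒳) [LocallyQuasiFinite ν.left] {N : ℕ} (hN : 2 ≤ N)
    {k₂ F : complexBetti 𝒳 2} {a : ℂ} (hF : F = fiberGysin hf t 0 (singularCohomology.one ℂ (ComplexPoints (fiberOver f t))))
    (hK : D.Hη = k₂ + a • F) (hk₂ : complexBetti.map ν 2 k₂ = ((N : ℂ) ^ 2) • k₂) {p m : ℕ} (hpm : 2 * (p + 1) + m = d)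
    (hwt : ∀ w : complexBetti 𝒳 (2 * (p + 1)), complexBetti.map (fiberι f t) (2 * (p + 1)) (complexBetti.map ν (2 * (p + 1)) w) =
      ((N : ℂ) ^ (2 * (p + 1))) • complexBetti.map (fiberι f t) (2 * (p + 1)) w)
    (hwt₃ : ∀ w : complexBetti 𝒳 (2 * (p + 1)), ∃ w₀ w₁ w₂ : complexBetti 𝒳 (2 * (p + 1)), w = w₀ + w₁ + w₂ ∧
      complexBetti.map ν (2 * (p + 1)) w₀ = ((N : ℂ) ^ (2 * (p + 1))) • w₀ ∧
      complexBetti.map ν (2 * (p + 1)) w₁ = ((N : ℂ) ^ (2 * p + 1)) • w₁ ∧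
      complexBetti.map ν (2 * (p + 1)) w₂ = ((N : ℂ) ^ (2 * p)) • w₂)
    (htop : ∀ G : complexBetti 𝒳 (2 * (p + 1 + m + 1)),
      complexBetti.map ν (2 * (p + 1 + m + 1)) G = ((N : ℂ) ^ (2 * (p + 1 + m + 1))) • G →
      complexBetti.map (fiberι f t) (2 * (p + 1 + m + 1)) G = 0 → G = 0)
    (hlift : (algebraicClasses (fiberOver f t) (p + 1)).comap (complexBetti.map (fiberι f t) (2 * (p + 1))).hom ≤
      algebraicClasses 𝒳 (p + 1) ⊔ LinearMap.ker (complexBetti.map (fiberι f t) (2 * (p + 1))).hom) :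
    ∀ ξ ∈ algebraicClasses (fiberOver f t) (p + 1),
      ξ ∈ primitiveClasses (complexBetti.map (fiberι f t) 2 D.Hη) d (2 * (p + 1)) →
      ξ ∈ LinearMap.range (complexBetti.map (fiberι f t) (2 * (p + 1))).hom →
      ∃ x ∈ algebraicClasses 𝒳 (p + 1),
        lefschetzPowTo D.Hη (m + 1) (2 * (p + 1)) (2 * (p + 1 + m + 1)) (by omega) x =
          fiberGysin hf t (p + 1 + m)
            (lefschetzPowTo (complexBetti.map (fiberι f t) 2 D.Hη) m (2 * (p + 1)) (2 * (p + 1 + m)) (by omega) ξ) := by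
  intro ξ hξalg hξP hξI
  obtain ⟨W₀, hW₀⟩ := hξI
  -- an ALGEBRAIC lift `y` of `ξ` from (L)_t(p+1)
  have hcomap : W₀ ∈ (algebraicClasses (fiberOver f t) (p + 1)).comap (complexBetti.map (fiberι f t) (2 * (p + 1))).hom := by
    rw [Submodule.mem_comap]
    change complexBetti.map (fiberι f t) (2 * (p + 1)) W₀ ∈ _
    rw [hW₀]
    exact hξalg
  obtain ⟨y, hy, k, hk, hyk⟩ := Submodule.mem_sup.1 (hlift hcomap)
  rw [LinearMap.mem_ker] at hk
  have hyξ : complexBetti.map (fiberι f t) (2 * (p + 1)) y = ξ := by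
    rw [← hW₀, ← hyk, map_add, hk, add_zero]
  -- its top-weight component `y₀` (algebraic, §1) and the identification (§2)
  obtain ⟨y₀, hy₀alg, hy₀wt, hy₀y⟩ := exists_topWeight_lift hf t ν hN hwt hwt₃ hy
  rw [hyξ] at hy₀y
  have hP : complexBetti.map (fiberι f t) (2 * (p + 1)) y₀ ∈ primitiveClasses (complexBetti.map (fiberι f t) 2 D.Hη) d (2 * (p + 1)) := by
    rw [hy₀y]
    exact hξP
  have hid := lefschetzPowTo_topWeight_eq_smul_fiberGysin hf t ν N hF hK hk₂ hpm htop hy₀wt hP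
  rw [hy₀y] at hid
  by_cases hc : ((m : ℂ) + 1) * a = 0
  · -- then `L_K^{m+1} y₀ = 0`, so `y₀ = 0` by hard Lefschetz and `ξ = 0`
    rw [hc, zero_smul] at hid
    have hinj := (bijective_lefschetzPowTo_of_hasHardLefschetz D.Hη (isPolarizationClass_Hη hf.isSmoothProjective_total D).hasHardLefschetz
      (show 2 * (p + 1) + (m + 1) = d + 1 by omega) (2 * (p + 1 + m + 1)) (by omega)).1
    have hy0 : y₀ = 0 := hinj (by rw [hid, map_zero])
    rw [hy0, map_zero] at hy₀y
    refine ⟨0, Submodule.zero_mem _, ?_⟩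
    rw [map_zero, ← hy₀y, map_zero, map_zero]
  · refine ⟨(((m : ℂ) + 1) * a)⁻¹ • y₀, Submodule.smul_mem _ _ hy₀alg, ?_⟩
    rw [map_smul, hid, smul_smul, inv_mul_cancel₀ hc, one_smul]

/-- **EXACTNESS OF THE SHARPEST `B_min` CANDIDATE OF GEN 15, ALL DEGREES AT `t`.** On a compact pencil of abelian `d`-folds carrying a locally
quasi-finite endomorphism `ν` with the Leray weights in every degree ((wt), (wt₃), (top) — print theorems for `θ_N`) and for a Kähler–rational
datum `D` polarising the fibres that is `ν`-symmetric modulo `[X_t]`: **[∀ p, (L)_t(p)] ⟺ [∀ p, the fibre-supported clause of part XXIII-f at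
`(t, D, p)`]**. (⟹) is `fibreLefschetzDegree_of_comap_le_sup_of_weights`; (⟸) is part XXIII-f/g with Lieberman's theorem for the fibre
(`primitiveLift_succ_of_fibreLefschetzDegree'`, `comap_le_sup_of_primitiveLift`, `standardConjectureA_fiberOver`). No `HC_CM`, no named fact.
[cite: Grothendieck1968, §3 p. 196 (A(X))] [cite: Lieberman1968, Thm. 1] [cite: Milne2020HodgeClassesAV, proof of Prop. 1 (p. 7)]
[cite: Abdulali1994FamiliesAV, p. 1122] [cite: DeningerMurre1991, Thm. 3.1] -/
theorem forall_comap_le_sup_iff_forall_fibreLefschetzDegree_of_weights (hf : IsCompactAbelianPencil f d) (t : ComplexPoints S)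
    (D : KaehlerRationalDatum (d + 1) 𝒳)
    (hKs : ∀ s : ComplexPoints S, HasHardLefschetzProperty (complexBetti.map (fiberι f s) 2 D.Hη) d)
    (hKt : IsPolarizationClass d (fiberOver f t) (complexBetti.map (fiberι f t) 2 D.Hη))
    (ν : 𝒳 ⟶ 𝒳) [LocallyQuasiFinite ν.left] {N : ℕ} (hN : 2 ≤ N)
    {k₂ F : complexBetti 𝒳 2} {a : ℂ} (hF : F = fiberGysin hf t 0 (singularCohomology.one ℂ (ComplexPoints (fiberOver f t))))
    (hK : D.Hη = k₂ + a • F) (hk₂ : complexBetti.map ν 2 k₂ = ((N : ℂ) ^ 2) • k₂)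
    (hwt : ∀ (k : ℕ) (w : complexBetti 𝒳 k), complexBetti.map (fiberι f t) k (complexBetti.map ν k w) =
      ((N : ℂ) ^ k) • complexBetti.map (fiberι f t) k w)
    (hwt₃ : ∀ (k k₁ k₂' : ℕ), k₁ + 1 = k → k₂' + 1 = k₁ → ∀ w : complexBetti 𝒳 k, ∃ w₀ w₁ w₂ : complexBetti 𝒳 k,
      w = w₀ + w₁ + w₂ ∧ complexBetti.map ν k w₀ = ((N : ℂ) ^ k) • w₀ ∧ complexBetti.map ν k w₁ = ((N : ℂ) ^ k₁) • w₁ ∧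
      complexBetti.map ν k w₂ = ((N : ℂ) ^ k₂') • w₂)
    (htop : ∀ (k : ℕ) (G : complexBetti 𝒳 k), complexBetti.map ν k G = ((N : ℂ) ^ k) • G →
      complexBetti.map (fiberι f t) k G = 0 → G = 0) :
    (∀ p : ℕ, (algebraicClasses (fiberOver f t) p).comap (complexBetti.map (fiberι f t) (2 * p)).hom ≤
      algebraicClasses 𝒳 p ⊔ LinearMap.ker (complexBetti.map (fiberι f t) (2 * p)).hom) ↔
    ∀ (p m : ℕ) (hpm : 2 * (p + 1) + m = d), ∀ ξ ∈ algebraicClasses (fiberOver f t) (p + 1),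
      ξ ∈ primitiveClasses (complexBetti.map (fiberι f t) 2 D.Hη) d (2 * (p + 1)) →
      ξ ∈ LinearMap.range (complexBetti.map (fiberι f t) (2 * (p + 1))).hom →
      ∃ x ∈ algebraicClasses 𝒳 (p + 1),
        lefschetzPowTo D.Hη (m + 1) (2 * (p + 1)) (2 * (p + 1 + m + 1)) (by omega) x =
          fiberGysin hf t (p + 1 + m)
            (lefschetzPowTo (complexBetti.map (fiberι f t) 2 D.Hη) m (2 * (p + 1)) (2 * (p + 1 + m)) (by omega) ξ) := by
  refine ⟨fun hL p m hpm ↦ fibreLefschetzDegree_of_comap_le_sup_of_weights hf t D ν hN hF hK hk₂ hpm (hwt _)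
    (hwt₃ (2 * (p + 1)) (2 * p + 1) (2 * p) (by omega) (by omega)) (htop _) (hL (p + 1)), fun hA ↦ ?_⟩
  have hKalg : D.Hη ∈ algebraicClasses 𝒳 1 := (isPolarizationClass_Hη hf.isSmoothProjective_total D).mem_algebraicClasses
  have hAt := standardConjectureA_fiberOver hf t hKt
  intro p
  induction p using Nat.strong_induction_on with
  | _ p ih =>
    refine comap_le_sup_of_primitiveLift hf t hKalg hKs hKt p (fun p' r' q' _ _ h1 h2 ↦ (hAt.2 p' r' q' h1 h2).surjOn)
      fun r h2r hrp hrd ↦ ?_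
    obtain ⟨p', rfl⟩ : ∃ p', r = p' + 1 := ⟨r - 1, by omega⟩
    obtain ⟨m, hm⟩ : ∃ m, 2 * (p' + 1) + m = d := ⟨d - 2 * (p' + 1), by omega⟩
    exact primitiveLift_succ_of_fibreLefschetzDegree' hf t D hKs hKt hm (ih p' (by omega)) (hA p' m hm)

end Exactness

/-! ## §4 The lift as "canonical (top-weight) lifts are algebraic" -/

section CanonicalLift

variable {𝒳 S : SchemeOver ℂ} {d : ℕ} {f : 𝒳 ⟶ S}

/-- **(L)_t(p+1) ⟺ TOP-WEIGHT CLASSES WITH ALGEBRAIC RESTRICTION ARE ALGEBRAIC.** Granted (wt), (wt₃), (top) in degree `2(p+1)` for a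
locally quasi-finite endomorphism `ν` (print: `θ_N`): the lift (L)_t(p+1) holds iff every `y₀ ∈ H^{2p+2}(𝒳)` of top weight `N^{2p+2}` with
`j_t^* y₀ ∈ N^{p+1}(X_t)` lies in `N^{p+1}(𝒳)`. (⟹): an algebraic lift of `j_t^* y₀` has an algebraic top-weight component (part XXIV-a
§1), equal to `y₀` by uniqueness (top). (⟸): the top-weight component of any `W` with `j_t^*W` algebraic is algebraic and differs from `W` by a
class dying on `X_t`. In print language: `aH^{2r}(A_t)^π = j_t^*(aH⁰(S, R^{2r} f_*))`, Milne's last line. [cite: Milne2020HodgeClassesAV, proof of Prop. 1 (pp. 7–8)]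
[cite: Abdulali1994FamiliesAV, p. 1122] [cite: DeningerMurre1991, Thm. 3.1] -/
theorem comap_le_sup_iff_forall_topWeight_mem (hf : IsCompactAbelianPencil f d) (t : ComplexPoints S) (ν : 𝒳 ⟶ 𝒳)
    [LocallyQuasiFinite ν.left] {N : ℕ} (hN : 2 ≤ N) {p : ℕ}
    (hwt : ∀ w : complexBetti 𝒳 (2 * (p + 1)), complexBetti.map (fiberι f t) (2 * (p + 1)) (complexBetti.map ν (2 * (p + 1)) w) =
      ((N : ℂ) ^ (2 * (p + 1))) • complexBetti.map (fiberι f t) (2 * (p + 1)) w)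
    (hwt₃ : ∀ w : complexBetti 𝒳 (2 * (p + 1)), ∃ w₀ w₁ w₂ : complexBetti 𝒳 (2 * (p + 1)), w = w₀ + w₁ + w₂ ∧
      complexBetti.map ν (2 * (p + 1)) w₀ = ((N : ℂ) ^ (2 * (p + 1))) • w₀ ∧
      complexBetti.map ν (2 * (p + 1)) w₁ = ((N : ℂ) ^ (2 * p + 1)) • w₁ ∧
      complexBetti.map ν (2 * (p + 1)) w₂ = ((N : ℂ) ^ (2 * p)) • w₂)
    (htop : ∀ G : complexBetti 𝒳 (2 * (p + 1)), complexBetti.map ν (2 * (p + 1)) G = ((N : ℂ) ^ (2 * (p + 1))) • G →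
      complexBetti.map (fiberι f t) (2 * (p + 1)) G = 0 → G = 0) :
    (algebraicClasses (fiberOver f t) (p + 1)).comap (complexBetti.map (fiberι f t) (2 * (p + 1))).hom ≤
        algebraicClasses 𝒳 (p + 1) ⊔ LinearMap.ker (complexBetti.map (fiberι f t) (2 * (p + 1))).hom ↔
      ∀ y₀ : complexBetti 𝒳 (2 * (p + 1)), complexBetti.map ν (2 * (p + 1)) y₀ = ((N : ℂ) ^ (2 * (p + 1))) • y₀ →
        complexBetti.map (fiberι f t) (2 * (p + 1)) y₀ ∈ algebraicClasses (fiberOver f t) (p + 1) → y₀ ∈ algebraicClasses 𝒳 (p + 1) := by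
  refine ⟨fun hL y₀ hy₀ halg ↦ ?_, fun h W hW ↦ ?_⟩
  · have hcomap : y₀ ∈ (algebraicClasses (fiberOver f t) (p + 1)).comap (complexBetti.map (fiberι f t) (2 * (p + 1))).hom := halg
    obtain ⟨y, hy, k, hk, hyk⟩ := Submodule.mem_sup.1 (hL hcomap)
    rw [LinearMap.mem_ker] at hk
    have hyy₀ : complexBetti.map (fiberι f t) (2 * (p + 1)) y = complexBetti.map (fiberι f t) (2 * (p + 1)) y₀ := by
      conv_rhs => rw [← hyk, map_add, hk, add_zero]
    obtain ⟨y₀', hy₀'alg, hy₀'wt, hy₀'y⟩ := exists_topWeight_lift hf t ν hN hwt hwt₃ hy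
    rw [topWeight_eq_of_map_fiberι_eq t ν htop hy₀ hy₀'wt (by rw [hy₀'y, hyy₀])]
    exact hy₀'alg
  · obtain ⟨w₀, w₁, w₂, hsum, h₀, h₁, h₂⟩ := hwt₃ W
    have hW₀ : complexBetti.map (fiberι f t) (2 * (p + 1)) W = complexBetti.map (fiberι f t) (2 * (p + 1)) w₀ := by
      rw [hsum, map_add, map_add, map_fiberι_eq_zero_of_weight_lt t ν hN (by omega : 2 * p + 1 < 2 * (p + 1)) hwt h₁,
        map_fiberι_eq_zero_of_weight_lt t ν hN (by omega : 2 * p < 2 * (p + 1)) hwt h₂, add_zero, add_zero]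
    have hw₀alg : w₀ ∈ algebraicClasses 𝒳 (p + 1) := h w₀ h₀ (by rw [← hW₀]; exact hW)
    rw [show W = w₀ + (W - w₀) by abel]
    refine Submodule.add_mem_sup hw₀alg ?_
    rw [LinearMap.mem_ker, map_sub, sub_eq_zero]
    exact hW₀

end CanonicalLift

/-! ## §5 The lift as a dimension count: Abdulali's inequality (e2) and its equality -/

section Dimension

variable {𝒳 S : SchemeOver ℂ} {d : ℕ} {f : 𝒳 ⟶ S}

/-- **Abdulali's inequality (e2): `dim (N^{p+1}(𝒳) ∩ H^{2p+2}(𝒳)^{top weight}) ≤ dim (N^{p+1}(X_t) ∩ Im j_t^*)`** — `j_t^*` restricted to the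
top-weight algebraic classes is injective by (top) and lands in the invariant algebraic classes of the fibre ("`j_s^* : H⁰(S, R^{2r} f_*) ↪
H^{2r}(A_s)^π` preserving algebraic classes, and so `dim aH⁰(S, R^{2r} f_*) ≤ dim aH^{2r}(A_s)^π`"). [cite: Milne2020HodgeClassesAV, proof of Prop. 1, (e2) (p. 7)]
[cite: Abdulali1994FamiliesAV, p. 1122] -/
theorem finrank_topWeight_le (hf : IsCompactAbelianPencil f d) (t : ComplexPoints S) (ν : 𝒳 ⟶ 𝒳) {N : ℕ} {p : ℕ}
    (htop : ∀ G : complexBetti 𝒳 (2 * (p + 1)), complexBetti.map ν (2 * (p + 1)) G = ((N : ℂ) ^ (2 * (p + 1))) • G →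
      complexBetti.map (fiberι f t) (2 * (p + 1)) G = 0 → G = 0) :
    Module.finrank ℂ ↥(algebraicClasses 𝒳 (p + 1) ⊓
        LinearMap.ker ((complexBetti.map ν (2 * (p + 1))).hom - ((N : ℂ) ^ (2 * (p + 1))) • LinearMap.id)) ≤
      Module.finrank ℂ ↥(algebraicClasses (fiberOver f t) (p + 1) ⊓
        LinearMap.range (complexBetti.map (fiberι f t) (2 * (p + 1))).hom) := by
  haveI := finite_complexBetti (hf.isSmoothProjective_fiberOver t) (2 * (p + 1))
  set A := algebraicClasses 𝒳 (p + 1) ⊓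
    LinearMap.ker ((complexBetti.map ν (2 * (p + 1))).hom - ((N : ℂ) ^ (2 * (p + 1))) • LinearMap.id) with hA
  set B := algebraicClasses (fiberOver f t) (p + 1) ⊓ LinearMap.range (complexBetti.map (fiberι f t) (2 * (p + 1))).hom with hB
  have hmaps : ∀ y ∈ A, (complexBetti.map (fiberι f t) (2 * (p + 1))).hom y ∈ B := fun y hy ↦
    Submodule.mem_inf.2 ⟨algebraicClasses_sup_ker_le_comap hf (p + 1) t (Submodule.mem_sup_left (Submodule.mem_inf.1 hy).1),
      ⟨y, rfl⟩⟩
  let φ : A →ₗ[ℂ] B := ((complexBetti.map (fiberι f t) (2 * (p + 1))).hom.domRestrict A).codRestrict B fun y ↦ hmaps y y.2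
  have hφ : Function.Injective φ := by
    refine (injective_iff_map_eq_zero φ).2 fun y hy ↦ Subtype.ext ?_
    have hy' : complexBetti.map (fiberι f t) (2 * (p + 1)) (y : complexBetti 𝒳 (2 * (p + 1))) = 0 := congrArg Subtype.val hy
    have hwt : complexBetti.map ν (2 * (p + 1)) (y : complexBetti 𝒳 (2 * (p + 1))) =
        ((N : ℂ) ^ (2 * (p + 1))) • (y : complexBetti 𝒳 (2 * (p + 1))) := by
      have h := (Submodule.mem_inf.1 y.2).2
      rw [LinearMap.mem_ker, LinearMap.sub_apply, sub_eq_zero] at h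
      exact h
    exact htop _ hwt hy'
  exact LinearMap.finrank_le_finrank_of_injective hφ

/-- **(L)_t(p+1) ⟺ ABDULALI'S INEQUALITY (e2) IS AN EQUALITY: `dim (N^{p+1}(𝒳) ∩ H^{2p+2}(𝒳)^{wt 2p+2}) = dim (N^{p+1}(X_t) ∩ Im j_t^*)`.**
Granted (wt), (wt₃), (top) in degree `2(p+1)` for a locally quasi-finite `ν` (print: `θ_N`): `j_t^*` maps the top-weight algebraic classes
injectively into the invariant algebraic classes of the fibre, and ONTO them iff (L)_t(p+1) (every invariant algebraic class then has an
algebraic top-weight lift, part XXIV-a §1). The W₆ habitat question in one number: at an `E`-power point of a large-monodromy sextic pencil,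
`dim N³(𝒳⁷)^{wt 6}` must be `dim (N³(X_t) ∩ I₆)`. [cite: Milne2020HodgeClassesAV, proof of Prop. 1, (e2) and last line (pp. 7–8)]
[cite: Abdulali1994FamiliesAV, p. 1122] [cite: DeningerMurre1991, Thm. 3.1] -/
theorem comap_le_sup_iff_finrank_topWeight_eq (hf : IsCompactAbelianPencil f d) (t : ComplexPoints S) (ν : 𝒳 ⟶ 𝒳)
    [LocallyQuasiFinite ν.left] {N : ℕ} (hN : 2 ≤ N) {p : ℕ}
    (hwt : ∀ w : complexBetti 𝒳 (2 * (p + 1)), complexBetti.map (fiberι f t) (2 * (p + 1)) (complexBetti.map ν (2 * (p + 1)) w) =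
      ((N : ℂ) ^ (2 * (p + 1))) • complexBetti.map (fiberι f t) (2 * (p + 1)) w)
    (hwt₃ : ∀ w : complexBetti 𝒳 (2 * (p + 1)), ∃ w₀ w₁ w₂ : complexBetti 𝒳 (2 * (p + 1)), w = w₀ + w₁ + w₂ ∧
      complexBetti.map ν (2 * (p + 1)) w₀ = ((N : ℂ) ^ (2 * (p + 1))) • w₀ ∧
      complexBetti.map ν (2 * (p + 1)) w₁ = ((N : ℂ) ^ (2 * p + 1)) • w₁ ∧
      complexBetti.map ν (2 * (p + 1)) w₂ = ((N : ℂ) ^ (2 * p)) • w₂)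
    (htop : ∀ G : complexBetti 𝒳 (2 * (p + 1)), complexBetti.map ν (2 * (p + 1)) G = ((N : ℂ) ^ (2 * (p + 1))) • G →
      complexBetti.map (fiberι f t) (2 * (p + 1)) G = 0 → G = 0) :
    (algebraicClasses (fiberOver f t) (p + 1)).comap (complexBetti.map (fiberι f t) (2 * (p + 1))).hom ≤
        algebraicClasses 𝒳 (p + 1) ⊔ LinearMap.ker (complexBetti.map (fiberι f t) (2 * (p + 1))).hom ↔
      Module.finrank ℂ ↥(algebraicClasses 𝒳 (p + 1) ⊓
          LinearMap.ker ((complexBetti.map ν (2 * (p + 1))).hom - ((N : ℂ) ^ (2 * (p + 1))) • LinearMap.id)) =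
        Module.finrank ℂ ↥(algebraicClasses (fiberOver f t) (p + 1) ⊓
          LinearMap.range (complexBetti.map (fiberι f t) (2 * (p + 1))).hom) := by
  haveI := finite_complexBetti (hf.isSmoothProjective_fiberOver t) (2 * (p + 1))
  haveI := finite_complexBetti hf.isSmoothProjective_total (2 * (p + 1))
  set A := algebraicClasses 𝒳 (p + 1) ⊓
    LinearMap.ker ((complexBetti.map ν (2 * (p + 1))).hom - ((N : ℂ) ^ (2 * (p + 1))) • LinearMap.id) with hA
  set B := algebraicClasses (fiberOver f t) (p + 1) ⊓ LinearMap.range (complexBetti.map (fiberι f t) (2 * (p + 1))).hom with hB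
  have hmemA : ∀ {y : complexBetti 𝒳 (2 * (p + 1))}, y ∈ algebraicClasses 𝒳 (p + 1) →
      complexBetti.map ν (2 * (p + 1)) y = ((N : ℂ) ^ (2 * (p + 1))) • y → y ∈ A := fun hy hwt ↦
    Submodule.mem_inf.2 ⟨hy, by rw [LinearMap.mem_ker, LinearMap.sub_apply, sub_eq_zero]; exact hwt⟩
  have hwtA : ∀ y ∈ A, complexBetti.map ν (2 * (p + 1)) y = ((N : ℂ) ^ (2 * (p + 1))) • y := fun y hy ↦ by
    have h := (Submodule.mem_inf.1 hy).2
    rw [LinearMap.mem_ker, LinearMap.sub_apply, sub_eq_zero] at h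
    exact h
  have hmaps : ∀ y ∈ A, (complexBetti.map (fiberι f t) (2 * (p + 1))).hom y ∈ B := fun y hy ↦
    Submodule.mem_inf.2 ⟨algebraicClasses_sup_ker_le_comap hf (p + 1) t (Submodule.mem_sup_left (Submodule.mem_inf.1 hy).1),
      ⟨y, rfl⟩⟩
  let φ : A →ₗ[ℂ] B := ((complexBetti.map (fiberι f t) (2 * (p + 1))).hom.domRestrict A).codRestrict B fun y ↦ hmaps y y.2
  have hφval : ∀ y : A, ((φ y : B) : complexBetti (fiberOver f t) (2 * (p + 1))) =
      complexBetti.map (fiberι f t) (2 * (p + 1)) (y : complexBetti 𝒳 (2 * (p + 1))) := fun _ ↦ rfl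
  have hφ : Function.Injective φ := by
    refine (injective_iff_map_eq_zero φ).2 fun y hy ↦ Subtype.ext ?_
    exact htop _ (hwtA _ y.2) (by rw [← hφval, hy]; rfl)
  -- (L)_t(p+1) ⟺ `φ` surjective
  have htopB : ∀ b : B, ∃ w₀ : complexBetti 𝒳 (2 * (p + 1)),
      complexBetti.map ν (2 * (p + 1)) w₀ = ((N : ℂ) ^ (2 * (p + 1))) • w₀ ∧
        complexBetti.map (fiberι f t) (2 * (p + 1)) w₀ = (b : complexBetti (fiberOver f t) (2 * (p + 1))) := by
    rintro ⟨ξ, -, W, hW⟩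
    obtain ⟨w₀, w₁, w₂, hsum, h₀, h₁, h₂⟩ := hwt₃ W
    refine ⟨w₀, h₀, ?_⟩
    change _ = ξ
    rw [← hW]
    change _ = complexBetti.map (fiberι f t) (2 * (p + 1)) W
    rw [hsum, map_add, map_add, map_fiberι_eq_zero_of_weight_lt t ν hN (by omega : 2 * p + 1 < 2 * (p + 1)) hwt h₁,
      map_fiberι_eq_zero_of_weight_lt t ν hN (by omega : 2 * p < 2 * (p + 1)) hwt h₂, add_zero, add_zero]
  rw [comap_le_sup_iff_forall_topWeight_mem hf t ν hN hwt hwt₃ htop]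
  refine ⟨fun h ↦ ?_, fun heq y₀ hy₀ halg ↦ ?_⟩
  · have hsurj : Function.Surjective φ := by
      intro b
      obtain ⟨w₀, hw₀, hw₀b⟩ := htopB b
      have hw₀alg : w₀ ∈ algebraicClasses 𝒳 (p + 1) := h w₀ hw₀ (by rw [hw₀b]; exact (Submodule.mem_inf.1 b.2).1)
      exact ⟨⟨w₀, hmemA hw₀alg hw₀⟩, Subtype.ext (by rw [hφval]; exact hw₀b)⟩
    exact (LinearEquiv.ofBijective φ ⟨hφ, hsurj⟩).finrank_eq
  · have hsurj : Function.Surjective φ := (LinearMap.injective_iff_surjective_of_finrank_eq_finrank heq).1 hφ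
    obtain ⟨a, ha⟩ := hsurj ⟨complexBetti.map (fiberι f t) (2 * (p + 1)) y₀, halg, y₀, rfl⟩
    have ha' : complexBetti.map (fiberι f t) (2 * (p + 1)) (a : complexBetti 𝒳 (2 * (p + 1))) =
        complexBetti.map (fiberι f t) (2 * (p + 1)) y₀ := by
      rw [← hφval, ha]
    rw [← topWeight_eq_of_map_fiberι_eq t ν htop (hwtA _ a.2) hy₀ ha']
    exact (Submodule.mem_inf.1 a.2).1

end Dimension

end Summit.HodgeConjecture.HodgeConjecture.Ring2.AbelianAll

end
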